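import Literature.Analysis.FluidPDE.ConfinedHardSphereFlowRestart
import Literature.Analysis.FluidPDE.HardSphereShortTime
import HarnessLib

/-!
# Short-time analysis of the confined hard-sphere flow on the torus among round scatterers

Seventh layer of the proof of `ConfinedHardSphereFlow.nonempty_torus_balls` (existence of the
confined hard-sphere flow on the torus among fixed round scatterers; Cercignani–Illner–Pulvirenti
1994 Thm. 4.2.1, App. 4.A p. 111; iteration scheme of Gallagher–Saint-Raymond–Texier 2013,
proof of Prop. 4.1.1 and Lemma 4.1.2): the deterministic analysis of the event-by-event
confined flow `ConfinedAlexander.fwdFlow` over a short window `[0, δ]` on the flat torus, for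
`N` spheres of diameter `ε` among the round scatterers `Wall.balls (Torus.geometry d) ctr ρ hρ`.
It extends `Literature.Analysis.FluidPDE.HardSphereShortTime` (wall-free case, whose pair
pieces `farSet` / `noHitPiece` / `hitPiece`, two-body map `pairCollide` and hypotheses `HitHyp`
are reused) by the sphere–scatterer events:

* displacement and chart lemmas for the distance of a sphere to a fixed centre under free flight;
* `wallFar`, `WallOthersFar`, `wallNoHitPiece`, `wallHitPiece` and the **confined short-time good
  set** `cShortGood = (shortGood ∩ wallFar) ∪ ⋃_q (wallNoHitPiece q ∪ wallHitPiece q)`;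
* on each piece the confined flow is forward regular up to `δ` (`FwdGoodUpTo`) and at time `δ`
  equals free flight after an explicit *kick*: the identity (no event), `pairCollide` (one binary
  collision, walls far) or the one-particle billiard `wallCollide` (one specular reflection at
  one scatterer, pairs far) — `fwdGoodUpTo_of_mem_cShortGood`, `fwdFlow_eq_freeFlight_cKick`;
* the kick `cKick` is injective on the confined short-time good part of an energy shell
  (`cKick_injOn`).

The thinness of the complement of `cShortGood` and the volume preservation of the kicks are in
`ConfinedHardSphereFlowShortBad` and `ConfinedHardSphereFlowScattering`.

## References

* I. Gallagher, L. Saint-Raymond, B. Texier, *From Newton to Boltzmann* (2013), §4.1, proof of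
  Prop. 4.1.1 and Lemma 4.1.2 (p. 19).
* C. Cercignani, R. Illner, M. Pulvirenti, *The Mathematical Theory of Dilute Gases*, Springer
  (1994), §4.2, App. 4.A (p. 111: reflecting boundaries).
-/

open Set Filter Function MeasureTheory Metric
open scoped ENNReal Topology InnerProductSpace

namespace Literature.Analysis.FluidPDE

noncomputable section

section Kinetic

namespace ConfinedAlexander

variable {d : Type*} [Fintype d] {N : ℕ} {ι : Type*}

/-! ## A sphere and a fixed centre under free flight on the torus -/

/-- Under free flight the minimal-image distance of a sphere to a fixed point decreases by at
most `|t| ‖v_i‖`. [folklore] -/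
theorem norm_sepVec_freeFlight_point_ge (z : Config N d (UnitAddTorus d)) (t : ℝ) (i : Fin N)
    (c : UnitAddTorus d) :
    ‖(Torus.geometry d).sepVec (z i).1 c‖ - |t| * ‖(z i).2‖ ≤
      ‖(Torus.geometry d).sepVec (freeFlight (Torus.geometry d) t z i).1 c‖ := by
  simp only [freeFlight_apply, Torus.geometry_translate, Torus.norm_geometry_sepVec]
  have h := Torus.euclidDist_le_euclidDist_translate (z i).1 c (t • (z i).2) 0
  rw [FunctionSpaces.Torus.proj_zero, add_zero, sub_zero, norm_smul, Real.norm_eq_abs] at h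
  linarith

/-- **A sphere far from a scatterer stays off it during the window**: speeds `≤ V`, `2Vδ ≤ r`,
`‖x_i - c‖ > ρ + r` give `‖x_i(t) - c‖ > ρ` for `|t| ≤ δ`. [folklore] -/
theorem lt_norm_sepVec_freeFlight_point_of_far {z : Config N d (UnitAddTorus d)} {V r δ ρ t : ℝ}
    (hV : ∀ i, ‖(z i).2‖ ≤ V) (hr : 2 * V * δ ≤ r) {i : Fin N} {c : UnitAddTorus d}
    (hfar : ρ + r < ‖(Torus.geometry d).sepVec (z i).1 c‖) (ht : |t| ≤ δ) :
    ρ < ‖(Torus.geometry d).sepVec (freeFlight (Torus.geometry d) t z i).1 c‖ := by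
  have h := norm_sepVec_freeFlight_point_ge z t i c
  have hV0 : 0 ≤ V := (norm_nonneg _).trans (hV i)
  have h1 : |t| * ‖(z i).2‖ ≤ δ * V := mul_le_mul ht (hV i) (norm_nonneg _) ((abs_nonneg t).trans ht)
  have h2 : 0 ≤ δ * V := mul_nonneg ((abs_nonneg t).trans ht) hV0
  have h3 : 2 * V * δ = 2 * (δ * V) := by ring
  linarith

/-- The same with two successive free flights and changed velocities in between. [folklore] -/
theorem lt_norm_sepVec_freeFlight_point_of_far₂ {z z' : Config N d (UnitAddTorus d)}
    {V r δ ρ s t : ℝ} (hV : ∀ i, ‖(z i).2‖ ≤ V) (hV' : ∀ i, ‖(z' i).2‖ ≤ V)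
    (hpos : ∀ i, (z' i).1 = (freeFlight (Torus.geometry d) s z i).1) (hr : 2 * V * δ ≤ r)
    (hs : 0 ≤ s) (hst : s + |t| ≤ δ) {i : Fin N} {c : UnitAddTorus d}
    (hfar : ρ + r < ‖(Torus.geometry d).sepVec (z i).1 c‖) :
    ρ < ‖(Torus.geometry d).sepVec (freeFlight (Torus.geometry d) t z' i).1 c‖ := by
  have h1 := norm_sepVec_freeFlight_point_ge z s i c
  have h2 := norm_sepVec_freeFlight_point_ge z' t i c
  rw [hpos i] at h2
  have hV0 : 0 ≤ V := (norm_nonneg _).trans (hV i)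
  have h3 : |s| * ‖(z i).2‖ ≤ s * V := by
    rw [abs_of_nonneg hs]; exact mul_le_mul_of_nonneg_left (hV i) hs
  have h4 : |t| * ‖(z' i).2‖ ≤ |t| * V := mul_le_mul_of_nonneg_left (hV' i) (abs_nonneg t)
  nlinarith [abs_nonneg t]

/-- **The chart of a sphere and a centre along free flight**: as long as `‖q‖ + |t| ‖v‖ < 1/2`
(`q = x_i - c` the minimal image), the separation vector in `S_t z` is `q + t v`. [folklore] -/
theorem sepVec_freeFlight_point_eq {z : Config N d (UnitAddTorus d)} {t : ℝ} {i : Fin N}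
    {c : UnitAddTorus d} (h : ‖(Torus.geometry d).sepVec (z i).1 c‖ + |t| * ‖(z i).2‖ < 1 / 2) :
    (Torus.geometry d).sepVec (freeFlight (Torus.geometry d) t z i).1 c =
      (Torus.geometry d).sepVec (z i).1 c + t • (z i).2 := by
  simp only [freeFlight_apply]
  have h' : ‖(Torus.geometry d).sepVec (z i).1 c‖ + ‖t • (z i).2 - 0‖ < 1 / 2 := by
    rwa [sub_zero, norm_smul, Real.norm_eq_abs]
  have key := Torus.sepVec_translate_of_norm_lt h'
  rwa [Geometry.translate_zero, sub_zero] at key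

/-- The chart hypothesis for a close sphere–centre pair during the window. [folklore] -/
theorem chart_bound_point {z : Config N d (UnitAddTorus d)} {V r δ ρ : ℝ} (hV : ∀ i, ‖(z i).2‖ ≤ V)
    (hr : 2 * V * δ ≤ r) (hρr : ρ + 2 * r < 2⁻¹) {i : Fin N} {c : UnitAddTorus d}
    (hq : ‖(Torus.geometry d).sepVec (z i).1 c‖ ≤ ρ + r) {t : ℝ} (ht : |t| ≤ δ) :
    ‖(Torus.geometry d).sepVec (z i).1 c‖ + |t| * ‖(z i).2‖ < 1 / 2 := by
  have hV0 : 0 ≤ V := (norm_nonneg _).trans (hV i)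
  have h1 : |t| * ‖(z i).2‖ ≤ δ * V := mul_le_mul ht (hV i) (norm_nonneg _) ((abs_nonneg t).trans ht)
  have : (2⁻¹ : ℝ) = 1 / 2 := by norm_num
  have h3 : 2 * V * δ = 2 * (δ * V) := by ring
  have h4 : 0 ≤ δ * V := mul_nonneg ((abs_nonneg t).trans ht) hV0
  linarith

/-! ## The pieces of the confined short-time good set -/

variable {ctr : ι → UnitAddTorus d} {ρ : ℝ} (hρ : 0 < ρ) {ε r δ V : ℝ}

/-- Membership in `cShortGood`. [folklore] -/
theorem mem_cShortGood {z : Config N d (UnitAddTorus d)} :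
    z ∈ cShortGood N ctr ε ρ r δ ↔ (z ∈ Alexander.shortGood N ε r δ ∧ z ∈ wallFar N ctr ρ r) ∨
      ∃ q : Fin N × ι, z ∈ wallNoHitPiece N ctr ε ρ r δ q ∨ z ∈ wallHitPiece N ctr ε ρ r δ q := by
  simp only [cShortGood, mem_union, mem_inter_iff, mem_iUnion]

/-- A configuration of the hard-sphere domain all of whose spheres are at distance `≥ ρ` from all
centres is confined. [folklore] -/
theorem mem_confinedDomain_of_forall_le {z : Config N d (UnitAddTorus d)}
    (hz : z ∈ hardSphereDomain (Torus.geometry d) N ε)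
    (hw : ∀ (i : Fin N) (k : ι), ρ ≤ ‖(Torus.geometry d).sepVec (z i).1 (ctr k)‖) :
    z ∈ confinedDomain (Torus.geometry d) (Wall.balls (Torus.geometry d) ctr ρ hρ) N ε :=
  ⟨hz, hw⟩

/-- On `wallFar` every sphere is at distance `> ρ` from every centre, with room `r ≥ 0`. [folklore] -/
theorem lt_norm_of_mem_wallFar (hr : 0 ≤ r) {z : Config N d (UnitAddTorus d)} (hz : z ∈ wallFar N ctr ρ r)
    (i : Fin N) (k : ι) : ρ < ‖(Torus.geometry d).sepVec (z i).1 (ctr k)‖ := by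
  linarith [hz i k]

/-- When the others are far and the pair `q` is at distance `> ρ` resp. `≥ ρ`, all are. [folklore] -/
theorem lt_norm_of_wallOthersFar (hr : 0 ≤ r) {z : Config N d (UnitAddTorus d)} {q : Fin N × ι}
    (ho : WallOthersFar ctr ρ r z q) (hq : ρ < ‖(Torus.geometry d).sepVec (z q.1).1 (ctr q.2)‖)
    (i : Fin N) (k : ι) : ρ < ‖(Torus.geometry d).sepVec (z i).1 (ctr k)‖ := by
  by_cases h : (i, k) = q
  · obtain ⟨rfl, rfl⟩ := Prod.ext_iff.1 h; exact hq
  · linarith [ho (i, k) h]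

/-- When the others are far and the pair `q` is at distance `≥ ρ`, all are at distance `≥ ρ`. [folklore] -/
theorem le_norm_of_wallOthersFar (hr : 0 ≤ r) {z : Config N d (UnitAddTorus d)} {q : Fin N × ι}
    (ho : WallOthersFar ctr ρ r z q) (hq : ρ ≤ ‖(Torus.geometry d).sepVec (z q.1).1 (ctr q.2)‖)
    (i : Fin N) (k : ι) : ρ ≤ ‖(Torus.geometry d).sepVec (z i).1 (ctr k)‖ := by
  by_cases h : (i, k) = q
  · obtain ⟨rfl, rfl⟩ := Prod.ext_iff.1 h; exact hq
  · linarith [ho (i, k) h]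

/-! ## No event during the window -/

section NoEvent

variable {z : Config N d (UnitAddTorus d)}

/-- **No contact of either kind during the window means no event**: `τ(z) > δ`. [folklore] -/
theorem ofReal_lt_exitTime_of_forall [Finite ι] (hε' : ε < 2⁻¹) (hρ' : ρ < 2⁻¹) (hδ : 0 ≤ δ)
    (Hp : ∀ t ∈ Icc (0 : ℝ) δ, ∀ k l : Fin N, k ≠ l →
      ε < ‖(Torus.geometry d).sepVec (freeFlight (Torus.geometry d) t z k).1
        (freeFlight (Torus.geometry d) t z l).1‖)
    (Hw : ∀ t ∈ Icc (0 : ℝ) δ, ∀ (i : Fin N) (k : ι),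
      ρ < ‖(Torus.geometry d).sepVec (freeFlight (Torus.geometry d) t z i).1 (ctr k)‖) :
    ENNReal.ofReal δ < exitTime (Torus.geometry d) (Wall.balls (Torus.geometry d) ctr ρ hρ) ε z := by
  have hG := Torus.isHardSphereRegular_geometry (d := d) hε'
  have hGρ := Torus.isHardSphereRegular_geometry (d := d) hρ'
  have hz : z ∈ confinedDomain (Torus.geometry d) (Wall.balls (Torus.geometry d) ctr ρ hρ) N ε := by
    refine ⟨fun k l hkl => ?_, fun i k => ?_⟩
    · simpa using (Hp 0 ⟨le_rfl, hδ⟩ k l hkl).le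
    · simpa using (Hw 0 ⟨le_rfl, hδ⟩ i k).le
  by_contra hle
  rw [not_lt] at hle
  have hfin : exitTime (Torus.geometry d) (Wall.balls (Torus.geometry d) ctr ρ hρ) ε z ≠ ∞ :=
    ne_top_of_le_ne_top ENNReal.ofReal_ne_top hle
  have ht : (exitTime (Torus.geometry d) (Wall.balls (Torus.geometry d) ctr ρ hρ) ε z).toReal ∈ Icc (0 : ℝ) δ :=
    ⟨ENNReal.toReal_nonneg, ENNReal.toReal_le_of_le_ofReal hδ hle⟩
  rcases exists_event_freeFlight_exitTime hG hGρ hz hfin with ⟨k, l, hkl, hc, -⟩ | ⟨i, k, hc, -⟩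
  · exact (Hp _ ht k l hkl).ne' hc.2
  · exact (Hw _ ht i k).ne' (Wall.mem_balls_contact_iff.1 hc)

/-- **No contact during the window gives forward regularity up to `δ`.** [folklore] -/
theorem fwdGoodUpTo_of_forall [Finite ι] (hε' : ε < 2⁻¹) (hρ' : ρ < 2⁻¹) (hδ : 0 ≤ δ)
    (Hp : ∀ t ∈ Icc (0 : ℝ) δ, ∀ k l : Fin N, k ≠ l →
      ε < ‖(Torus.geometry d).sepVec (freeFlight (Torus.geometry d) t z k).1
        (freeFlight (Torus.geometry d) t z l).1‖)
    (Hw : ∀ t ∈ Icc (0 : ℝ) δ, ∀ (i : Fin N) (k : ι),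
      ρ < ‖(Torus.geometry d).sepVec (freeFlight (Torus.geometry d) t z i).1 (ctr k)‖) :
    FwdGoodUpTo (Torus.geometry d) (Wall.balls (Torus.geometry d) ctr ρ hρ) ε δ z := by
  set W := Wall.balls (Torus.geometry d) ctr ρ hρ
  have hτ := ofReal_lt_exitTime_of_forall hρ hε' hρ' hδ Hp Hw
  have h1 : ∀ k, ¬ eventInstant (Torus.geometry d) W ε z (k + 1) ≤ ENNReal.ofReal δ := by
    intro k hk
    have hmono : eventInstant (Torus.geometry d) W ε z 1 ≤ eventInstant (Torus.geometry d) W ε z (k + 1) :=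
      monotone_eventInstant z (by omega)
    rw [eventInstant_one] at hmono
    exact (not_le.2 hτ) (hmono.trans hk)
  refine ⟨fun k hk => (h1 k hk).elim, fun k t ht htk hkt => ?_, ⟨1, by rwa [eventInstant_one]⟩⟩
  cases k with
  | zero =>
    rw [eventInstant_zero, zero_add] at hkt
    rw [stateAfter_zero]
    have htI : t ∈ Icc (0 : ℝ) δ := ⟨ht.le, (ENNReal.ofReal_le_ofReal_iff hδ).1 hkt⟩
    exact ⟨fun i j hij hc => (Hp t htI i j hij).ne' hc.2,
      fun i k hc => (Hw t htI i k).ne' (Wall.mem_balls_contact_iff.1 hc)⟩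
  | succ k => exact (h1 k ((le_add_right le_rfl).trans hkt)).elim

/-- **No contact during the window: the confined flow is free flight on `[0, δ]`.** [folklore] -/
theorem fwdFlow_eq_freeFlight_of_forall [Finite ι] (hε' : ε < 2⁻¹) (hρ' : ρ < 2⁻¹) (hδ : 0 ≤ δ)
    (Hp : ∀ t ∈ Icc (0 : ℝ) δ, ∀ k l : Fin N, k ≠ l →
      ε < ‖(Torus.geometry d).sepVec (freeFlight (Torus.geometry d) t z k).1
        (freeFlight (Torus.geometry d) t z l).1‖)
    (Hw : ∀ t ∈ Icc (0 : ℝ) δ, ∀ (i : Fin N) (k : ι),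
      ρ < ‖(Torus.geometry d).sepVec (freeFlight (Torus.geometry d) t z i).1 (ctr k)‖)
    {s : ℝ} (hs : s ∈ Icc (0 : ℝ) δ) :
    fwdFlow (Torus.geometry d) (Wall.balls (Torus.geometry d) ctr ρ hρ) ε z s = freeFlight (Torus.geometry d) s z :=
  fwdFlow_eq_freeFlight_of_lt
    ((ENNReal.ofReal_le_ofReal hs.2).trans_lt (ofReal_lt_exitTime_of_forall hρ hε' hρ' hδ Hp Hw))

/-- On `wallFar` no sphere comes within distance `ρ` of a centre during the window. [folklore] -/
theorem forall_wall_of_mem_wallFar (hV : ∀ i, ‖(z i).2‖ ≤ V) (hr : 2 * V * δ ≤ r)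
    (hz : z ∈ wallFar N ctr ρ r) :
    ∀ t ∈ Icc (0 : ℝ) δ, ∀ (i : Fin N) (k : ι),
      ρ < ‖(Torus.geometry d).sepVec (freeFlight (Torus.geometry d) t z i).1 (ctr k)‖ :=
  fun t ht i k => lt_norm_sepVec_freeFlight_point_of_far hV hr (hz i k) (by rw [abs_of_nonneg ht.1]; exact ht.2)

/-- On a wall no-hit piece no sphere comes within distance `ρ` of a centre during the window. [folklore] -/
theorem forall_wall_of_mem_wallNoHitPiece (hρ0 : 0 < ρ) (hV : ∀ i, ‖(z i).2‖ ≤ V) (hr : 2 * V * δ ≤ r)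
    (hρr : ρ + 2 * r < 2⁻¹) {q : Fin N × ι} (hz : z ∈ wallNoHitPiece N ctr ε ρ r δ q) :
    ∀ t ∈ Icc (0 : ℝ) δ, ∀ (i : Fin N) (k : ι),
      ρ < ‖(Torus.geometry d).sepVec (freeFlight (Torus.geometry d) t z i).1 (ctr k)‖ := by
  obtain ⟨-, ho, hq, hq', hnh⟩ := hz
  intro t ht
  have ht' : |t| ≤ δ := by rw [abs_of_nonneg ht.1]; exact ht.2
  have hqq : ρ < ‖(Torus.geometry d).sepVec (freeFlight (Torus.geometry d) t z q.1).1 (ctr q.2)‖ := by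
    rw [sepVec_freeFlight_point_eq (chart_bound_point hV hr hρr hq' ht')]
    have key : ¬ PairHits ρ ((Torus.geometry d).sepVec (z q.1).1 (ctr q.2)) (z q.1).2 →
        ρ < ‖(Torus.geometry d).sepVec (z q.1).1 (ctr q.2) + t • (z q.1).2‖ := by
      intro hP
      rcases ht.1.eq_or_lt with h0 | htpos
      · rw [← h0, zero_smul, add_zero]; exact hq
      · exact lt_norm_add_smul_of_not_pairHits hρ0.le hq.le hP (Or.inl hq) htpos
    rcases hnh with hnh | hnh
    · exact key hnh
    · by_cases hP : PairHits ρ ((Torus.geometry d).sepVec (z q.1).1 (ctr q.2)) (z q.1).2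
      · exact lt_norm_add_smul_of_lt_pairHitTime hP (ht.2.trans_lt hnh)
      · exact key hP
  intro i k
  by_cases hik : (i, k) = q
  · obtain ⟨rfl, rfl⟩ := Prod.ext_iff.1 hik; exact hqq
  · exact lt_norm_sepVec_freeFlight_point_of_far hV hr (ho (i, k) hik) ht'

/-- On a wall no-hit piece no pair comes within distance `ε` during the window (all pairs far). [folklore] -/
theorem forall_pair_of_mem_wallNoHitPiece (hV : ∀ i, ‖(z i).2‖ ≤ V) (hr : 2 * V * δ ≤ r)
    {q : Fin N × ι} (hz : z ∈ wallNoHitPiece N ctr ε ρ r δ q) :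
    ∀ t ∈ Icc (0 : ℝ) δ, ∀ k l : Fin N, k ≠ l →
      ε < ‖(Torus.geometry d).sepVec (freeFlight (Torus.geometry d) t z k).1
        (freeFlight (Torus.geometry d) t z l).1‖ :=
  Alexander.forall_lt_norm_of_mem_farSet hV hr hz.1

end NoEvent

/-! ## One binary collision during the window, all scatterers far -/

namespace PairHit

variable {z : Config N d (UnitAddTorus d)} {i j : Fin N} (h : Alexander.HitHyp ε r δ V z i j)
  (hw : z ∈ wallFar N ctr ρ r)
include h hw

/-- The scatterers stay far before the collision: `ρ < ‖x_k(t) - c‖` for `|t| ≤ δ`. [folklore] -/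
theorem lt_norm_wall_freeFlight {t : ℝ} (ht : |t| ≤ δ) (k : Fin N) (l : ι) :
    ρ < ‖(Torus.geometry d).sepVec (freeFlight (Torus.geometry d) t z k).1 (ctr l)‖ :=
  lt_norm_sepVec_freeFlight_point_of_far h.norm_vel_le h.window (hw k l) ht

/-- The scatterers stay far after the collision: for the post-collisional state `z₁` of the
wall-free dynamics, `ρ < ‖x_k(t) - c‖` for `0 ≤ t`, `τ₀ + t ≤ δ`. [folklore] -/
theorem lt_norm_wall_freeFlight_stateAfter_one {t : ℝ} (ht : 0 ≤ t)
    (htδ : pairHitTime ε ((Torus.geometry d).sepVec (z i).1 (z j).1) ((z i).2 - (z j).2) + t ≤ δ)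
    (k : Fin N) (l : ι) :
    ρ < ‖(Torus.geometry d).sepVec (freeFlight (Torus.geometry d) t
        (Alexander.stateAfter (Torus.geometry d) ε z 1) k).1 (ctr l)‖ := by
  refine lt_norm_sepVec_freeFlight_point_of_far₂ h.norm_vel_le h.norm_vel_stateAfter_one_le
    h.stateAfter_one_apply_fst h.window h.hitTime_pos.le ?_ (hw k l)
  rw [abs_of_nonneg ht]; exact htδ

/-- **The confined exit time is the hitting time**: `τ(z) = τ₀` (no scatterer is reached). [folklore] -/
theorem exitTime_eq :
    exitTime (Torus.geometry d) (Wall.balls (Torus.geometry d) ctr ρ hρ) ε z =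
      ENNReal.ofReal (pairHitTime ε ((Torus.geometry d).sepVec (z i).1 (z j).1) ((z i).2 - (z j).2)) := by
  set W := Wall.balls (Torus.geometry d) ctr ρ hρ
  have hG := Torus.isHardSphereRegular_geometry (d := d) h.ε_lt
  have hge : ENNReal.ofReal (pairHitTime ε ((Torus.geometry d).sepVec (z i).1 (z j).1) ((z i).2 - (z j).2)) ≤
      exitTime (Torus.geometry d) W ε z := by
    refine le_exitTime_of_forall_mem fun t ht0 htlt => ?_
    have ht : t < pairHitTime ε ((Torus.geometry d).sepVec (z i).1 (z j).1) ((z i).2 - (z j).2) :=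
      (ENNReal.ofReal_lt_ofReal_iff_of_nonneg ht0).1 htlt
    refine ⟨fun k l hkl => (h.lt_norm_sepVec_freeFlight_of_lt ht0 ht hkl).le, fun k l => ?_⟩
    exact (lt_norm_wall_freeFlight h hw (by rw [abs_of_nonneg ht0]; exact ht.le.trans h.hitTime_le) k l).le
  have h0 := exitTime_eq_zero_of_isIncoming (W := W) hG h.ne h.freeFlight_hitTime_mem_contactSet
    h.isIncoming_freeFlight_hitTime
  have hadd := exitTime_freeFlight_add (G := Torus.geometry d) (W := W) (ε := ε) h.hitTime_pos.le hge
  rw [h0, zero_add] at hadd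
  exact hadd.symm

/-- The confined exit time is finite. [folklore] -/
theorem exitTime_ne_top : exitTime (Torus.geometry d) (Wall.balls (Torus.geometry d) ctr ρ hρ) ε z ≠ ∞ := by
  rw [exitTime_eq hρ h hw]; exact ENNReal.ofReal_ne_top

/-- The confined exit time as a real number. [folklore] -/
theorem toReal_exitTime :
    (exitTime (Torus.geometry d) (Wall.balls (Torus.geometry d) ctr ρ hρ) ε z).toReal =
      pairHitTime ε ((Torus.geometry d).sepVec (z i).1 (z j).1) ((z i).2 - (z j).2) := by
  rw [exitTime_eq hρ h hw, ENNReal.toReal_ofReal h.hitTime_pos.le]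

/-- **At the hitting time the configuration is a simple pair event with pair `(i, j)`.** [folklore] -/
theorem isSimplePairEventWith_freeFlight_hitTime :
    IsSimplePairEventWith (Torus.geometry d) (Wall.balls (Torus.geometry d) ctr ρ hρ) ε
      (freeFlight (Torus.geometry d)
        (pairHitTime ε ((Torus.geometry d).sepVec (z i).1 (z j).1) ((z i).2 - (z j).2)) z) (i, j) := by
  refine ⟨h.isSimpleIncomingWith_freeFlight_hitTime, fun k l hc => ?_⟩
  have ht : |pairHitTime ε ((Torus.geometry d).sepVec (z i).1 (z j).1) ((z i).2 - (z j).2)| ≤ δ := by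
    rw [abs_of_nonneg h.hitTime_pos.le]; exact h.hitTime_le
  exact (lt_norm_wall_freeFlight h hw ht k l).ne' (Wall.mem_balls_contact_iff.1 hc)

/-- **The confined event step is the collision of the pair at the hitting time.** [folklore] -/
theorem eventStep_eq :
    eventStep (Torus.geometry d) (Wall.balls (Torus.geometry d) ctr ρ hρ) ε z =
      collidePair (Torus.geometry d) i j (freeFlight (Torus.geometry d)
        (pairHitTime ε ((Torus.geometry d).sepVec (z i).1 (z j).1) ((z i).2 - (z j).2)) z) := by
  have hs := isSimplePairEventWith_freeFlight_hitTime hρ h hw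
  rw [← toReal_exitTime hρ h hw] at hs ⊢
  exact eventStep_eq_collidePair (exitTime_ne_top hρ h hw) hs

/-- The first confined post-event state is the wall-free one. [folklore] -/
theorem stateAfter_one :
    stateAfter (Torus.geometry d) (Wall.balls (Torus.geometry d) ctr ρ hρ) ε z 1 =
      Alexander.stateAfter (Torus.geometry d) ε z 1 := by
  rw [ConfinedAlexander.stateAfter_one, eventStep_eq hρ h hw, h.stateAfter_one]

variable [Finite ι] (hρ' : ρ < 2⁻¹)
include hρ'

/-- **The post-collisional state has no event within the window**: `τ(z₁) > δ - τ₀`. [folklore] -/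
theorem ofReal_lt_exitTime_stateAfter_one :
    ENNReal.ofReal (δ - pairHitTime ε ((Torus.geometry d).sepVec (z i).1 (z j).1) ((z i).2 - (z j).2)) <
      exitTime (Torus.geometry d) (Wall.balls (Torus.geometry d) ctr ρ hρ) ε
        (stateAfter (Torus.geometry d) (Wall.balls (Torus.geometry d) ctr ρ hρ) ε z 1) := by
  set W := Wall.balls (Torus.geometry d) ctr ρ hρ
  have hG := Torus.isHardSphereRegular_geometry (d := d) h.ε_lt
  have hGρ := Torus.isHardSphereRegular_geometry (d := d) hρ'
  set τ₀ := pairHitTime ε ((Torus.geometry d).sepVec (z i).1 (z j).1) ((z i).2 - (z j).2) with hτ₀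
  rw [stateAfter_one hρ h hw]
  have hmem : Alexander.stateAfter (Torus.geometry d) ε z 1 ∈ confinedDomain (Torus.geometry d) W N ε := by
    refine ⟨h.stateAfter_one_mem, fun k l => ?_⟩
    have := lt_norm_wall_freeFlight_stateAfter_one h hw le_rfl (by rw [add_zero]; exact h.hitTime_le) k l
    rw [freeFlight_zero] at this
    exact this.le
  by_contra hle
  rw [not_lt] at hle
  have hfin : exitTime (Torus.geometry d) W ε (Alexander.stateAfter (Torus.geometry d) ε z 1) ≠ ∞ :=
    ne_top_of_le_ne_top ENNReal.ofReal_ne_top hle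
  have hτ1 : (exitTime (Torus.geometry d) W ε (Alexander.stateAfter (Torus.geometry d) ε z 1)).toReal ≤ δ - τ₀ :=
    ENNReal.toReal_le_of_le_ofReal (by linarith [h.hitTime_le]) hle
  rcases (ENNReal.toReal_nonneg :
      0 ≤ (exitTime (Torus.geometry d) W ε (Alexander.stateAfter (Torus.geometry d) ε z 1)).toReal).eq_or_lt with h0 | hpos
  · rcases exists_event_freeFlight_exitTime hG hGρ hmem hfin with ⟨k, l, hkl, hc, hin⟩ | ⟨k, l, hc, -⟩
    · rw [← h0, freeFlight_zero] at hc hin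
      have hc' : freeFlight (Torus.geometry d) τ₀ z ∈ contactSet (Torus.geometry d) N ε k l :=
        (mem_contactSet_congr_fst fun m => (h.stateAfter_one_apply_fst m)).1 hc
      have hout := h.isSimpleIncomingWith_freeFlight_hitTime.isOutgoing_collidePair hG hkl hc'
      rw [← h.stateAfter_one] at hout
      exact lt_asymm hin hout
    · rw [← h0] at hc
      have := lt_norm_wall_freeFlight_stateAfter_one h hw le_rfl (by rw [add_zero]; exact h.hitTime_le) k l
      exact this.ne' (Wall.mem_balls_contact_iff.1 hc)
  · rcases exists_event_freeFlight_exitTime hG hGρ hmem hfin with ⟨k, l, hkl, hc, -⟩ | ⟨k, l, hc, -⟩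
    · exact (h.lt_norm_sepVec_freeFlight_stateAfter_one hpos (by linarith) hkl).ne' hc.2
    · exact (lt_norm_wall_freeFlight_stateAfter_one h hw hpos.le (by linarith) k l).ne' (Wall.mem_balls_contact_iff.1 hc)

/-- The second event instant is beyond the window. [folklore] -/
theorem ofReal_lt_eventInstant_two :
    ENNReal.ofReal δ < eventInstant (Torus.geometry d) (Wall.balls (Torus.geometry d) ctr ρ hρ) ε z 2 := by
  rw [eventInstant_succ, eventInstant_one, exitTime_eq hρ h hw]
  have hsplit : ENNReal.ofReal δ = ENNReal.ofReal (pairHitTime ε ((Torus.geometry d).sepVec (z i).1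
      (z j).1) ((z i).2 - (z j).2)) + ENNReal.ofReal (δ - pairHitTime ε
        ((Torus.geometry d).sepVec (z i).1 (z j).1) ((z i).2 - (z j).2)) := by
    rw [← ENNReal.ofReal_add h.hitTime_pos.le (by linarith [h.hitTime_le]), add_sub_cancel]
  rw [hsplit]
  exact ENNReal.add_lt_add_left ENNReal.ofReal_ne_top (ofReal_lt_exitTime_stateAfter_one hρ h hw hρ')

/-- **One binary collision during the window: forward regularity of the confined flow up to `δ`.** [folklore] -/
theorem fwdGoodUpTo : FwdGoodUpTo (Torus.geometry d) (Wall.balls (Torus.geometry d) ctr ρ hρ) ε δ z := by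
  set W := Wall.balls (Torus.geometry d) ctr ρ hρ
  have h2 := ofReal_lt_eventInstant_two hρ h hw hρ'
  have hk2 : ∀ k, 2 ≤ k → ¬ eventInstant (Torus.geometry d) W ε z k ≤ ENNReal.ofReal δ :=
    fun k hk hle => (not_le.2 h2) ((monotone_eventInstant z hk).trans hle)
  refine ⟨fun k hk => ?_, fun k t ht htk hkt => ?_, ⟨2, h2⟩⟩
  · cases k with
    | zero =>
      rw [stateAfter_zero, toReal_exitTime hρ h hw]
      exact (isSimplePairEventWith_freeFlight_hitTime hρ h hw).isSimplePairEvent.isSimpleEvent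
    | succ k => exact (hk2 (k + 2) (by omega) hk).elim
  · match k with
    | 0 =>
      rw [stateAfter_zero]
      rw [stateAfter_zero, exitTime_eq hρ h hw, ENNReal.ofReal_lt_ofReal_iff_of_nonneg ht.le] at htk
      refine ⟨fun a b hab hc => (h.lt_norm_sepVec_freeFlight_of_lt ht.le htk hab).ne' hc.2, fun a b hc => ?_⟩
      exact (lt_norm_wall_freeFlight h hw (by rw [abs_of_pos ht]; exact htk.le.trans h.hitTime_le) a b).ne'
        (Wall.mem_balls_contact_iff.1 hc)
    | 1 =>
      rw [eventInstant_one, exitTime_eq hρ h hw, ← ENNReal.ofReal_add h.hitTime_pos.le ht.le,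
        ENNReal.ofReal_le_ofReal_iff h.δ_pos.le] at hkt
      rw [stateAfter_one hρ h hw]
      refine ⟨fun a b hab hc => (h.lt_norm_sepVec_freeFlight_stateAfter_one ht hkt hab).ne' hc.2, fun a b hc => ?_⟩
      exact (lt_norm_wall_freeFlight_stateAfter_one h hw ht.le hkt a b).ne' (Wall.mem_balls_contact_iff.1 hc)
    | k + 2 => exact (hk2 (k + 2) (by omega) ((le_add_right le_rfl).trans hkt)).elim

/-- **One binary collision during the window: `Φ_δ z = S_δ (pairCollide ε i j z)`.** [folklore] -/
theorem fwdFlow_eq_freeFlight_pairCollide :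
    fwdFlow (Torus.geometry d) (Wall.balls (Torus.geometry d) ctr ρ hρ) ε z δ =
      freeFlight (Torus.geometry d) δ (Alexander.pairCollide ε i j z) := by
  have h1 : eventInstant (Torus.geometry d) (Wall.balls (Torus.geometry d) ctr ρ hρ) ε z 1 ≤ ENNReal.ofReal δ := by
    rw [eventInstant_one, exitTime_eq hρ h hw]; exact ENNReal.ofReal_le_ofReal h.hitTime_le
  rw [fwdFlow_eq_of_segment h1 (ofReal_lt_eventInstant_two hρ h hw hρ'), eventInstant_one,
    toReal_exitTime hρ h hw, stateAfter_one hρ h hw, ← h.freeFlight_neg_stateAfter_one, ← freeFlight_add,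
    sub_eq_add_neg]

end PairHit

/-! ## The one-particle billiard of a sphere at a round scatterer, on the torus -/

omit [Fintype d] in
/-- `wallCollide` does not touch the other spheres. [folklore] -/
theorem wallCollide_apply_of_ne [Fintype d] {ρ : ℝ} {ctr : ι → UnitAddTorus d} {q : Fin N × ι} {k : Fin N}
    (hk : k ≠ q.1) (z : Config N d (UnitAddTorus d)) : wallCollide ρ ctr q z k = z k := by
  simp [wallCollide, update_of_ne hk]

/-- `wallCollide` on the kicked sphere. [folklore] -/
@[simp]
theorem wallCollide_apply_self {ρ : ℝ} {ctr : ι → UnitAddTorus d} {q : Fin N × ι} (z : Config N d (UnitAddTorus d)) :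
    wallCollide ρ ctr q z q.1 = wallKickOne ρ (ctr q.2) (z q.1) := by
  simp [wallCollide]

/-- The specular reflection at a round scatterer in terms of `reflN`: for `‖n‖ = ρ > 0`,
`specularReflect (ρ⁻¹ n) v = reflN ρ n v`. [folklore] -/
theorem specularReflect_inv_smul_eq_reflN {ρ : ℝ} (hρ0 : 0 < ρ) {n : EuclideanSpace ℝ d} (hn : ‖n‖ = ρ)
    (v : EuclideanSpace ℝ d) : FunctionSpaces.specularReflect (ρ⁻¹ • n) v = reflN ρ n v := by
  rw [FunctionSpaces.specularReflect_eq, reflN_apply, norm_smul, Real.norm_eq_abs, abs_inv, abs_of_pos hρ0, hn,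
    inner_smul_right, real_inner_comm, smul_smul]
  congr 1
  field_simp

/-! ## One specular reflection during the window: the wall hit pieces -/

namespace WallHitHyp

variable {z : Config N d (UnitAddTorus d)} {q : Fin N × ι} (h : WallHitHyp ctr ε ρ r δ V z q)
include h

/-- The relative data lie in the billiard good set. [folklore] -/
theorem good : ((Torus.geometry d).sepVec (z q.1).1 (ctr q.2), (z q.1).2) ∈
    (billiardGood ρ : Set (EuclideanSpace ℝ d × EuclideanSpace ℝ d)) := h.mem.2.2.2.1

/-- The sphere hits the scatterer. [folklore] -/
theorem pairHits : PairHits ρ ((Torus.geometry d).sepVec (z q.1).1 (ctr q.2)) (z q.1).2 :=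
  PairHits.of_mem_billiardGood h.good

/-- The sphere starts strictly off the scatterer. [folklore] -/
theorem lt_norm : ρ < ‖(Torus.geometry d).sepVec (z q.1).1 (ctr q.2)‖ := h.good.1

/-- The hitting time is positive. [folklore] -/
theorem hitTime_pos : 0 < pairHitTime ρ ((Torus.geometry d).sepVec (z q.1).1 (ctr q.2)) (z q.1).2 :=
  pairHitTime_pos h.ρ_pos.le h.lt_norm h.pairHits

/-- The hitting time is within the window. [folklore] -/
theorem hitTime_le : pairHitTime ρ ((Torus.geometry d).sepVec (z q.1).1 (ctr q.2)) (z q.1).2 ≤ δ := h.mem.2.2.2.2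

/-- The window is positive. [folklore] -/
theorem δ_pos : 0 < δ := h.hitTime_pos.trans_le h.hitTime_le

/-- The interaction length is nonnegative. [folklore] -/
theorem r_nonneg : 0 ≤ r := le_trans (mul_nonneg (mul_nonneg two_pos.le h.V_nonneg) h.δ_pos.le) h.window

/-- The exclusion radius is below the chart bound. [folklore] -/
theorem ρ_lt : ρ < 2⁻¹ := by linarith [h.chart, h.r_nonneg]

/-- The diameter is below the chart bound. [folklore] -/
theorem ε_lt : ε < 2⁻¹ := by linarith [h.chartε, h.r_nonneg]

/-- Speeds of the datum are at most `V`. [folklore] -/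
theorem norm_vel_le (k : Fin N) : ‖(z k).2‖ ≤ V := norm_vel_le_of_configEnergy_le h.V_nonneg h.energy k

/-- All pairs are far. [folklore] -/
theorem farSet : z ∈ Alexander.farSet N ε r := h.mem.1

/-- The other sphere–scatterer pairs are far. [folklore] -/
theorem othersFar : WallOthersFar ctr ρ r z q := h.mem.2.1

/-- The sphere is close to the scatterer. [folklore] -/
theorem norm_le : ‖(Torus.geometry d).sepVec (z q.1).1 (ctr q.2)‖ ≤ ρ + r := h.mem.2.2.1

/-- The datum is confined. [folklore] -/
theorem mem_confinedDomain : z ∈ confinedDomain (Torus.geometry d) (Wall.balls (Torus.geometry d) ctr ρ hρ) N ε :=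
  ⟨Alexander.farSet_subset_hardSphereDomain h.r_nonneg h.farSet, le_norm_of_wallOthersFar h.r_nonneg h.othersFar h.lt_norm.le⟩

/-- The separation vector at contact has norm `ρ`. [folklore] -/
theorem norm_hitPoint : ‖hitPoint ρ ((Torus.geometry d).sepVec (z q.1).1 (ctr q.2), (z q.1).2)‖ = ρ :=
  FluidPDE.norm_hitPoint h.ρ_pos.le h.good

/-- During the window every pair is at distance `> ε` along the free flight of `z`. [folklore] -/
theorem lt_norm_pair_freeFlight {t : ℝ} (ht : |t| ≤ δ) {k l : Fin N} (hkl : k ≠ l) :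
    ε < ‖(Torus.geometry d).sepVec (freeFlight (Torus.geometry d) t z k).1 (freeFlight (Torus.geometry d) t z l).1‖ :=
  Alexander.lt_norm_sepVec_freeFlight_of_far h.norm_vel_le h.window (h.farSet k l hkl) ht

/-- During the window the other sphere–scatterer pairs stay at distance `> ρ`. [folklore] -/
theorem lt_norm_wall_freeFlight_of_ne {t : ℝ} (ht : |t| ≤ δ) {q' : Fin N × ι} (hq' : q' ≠ q) :
    ρ < ‖(Torus.geometry d).sepVec (freeFlight (Torus.geometry d) t z q'.1).1 (ctr q'.2)‖ :=
  lt_norm_sepVec_freeFlight_point_of_far h.norm_vel_le h.window (h.othersFar q' hq') ht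

/-- The chart of the interacting pair along the free flight of `z`. [folklore] -/
theorem sepVec_freeFlight_eq {t : ℝ} (ht : |t| ≤ δ) :
    (Torus.geometry d).sepVec (freeFlight (Torus.geometry d) t z q.1).1 (ctr q.2) =
      (Torus.geometry d).sepVec (z q.1).1 (ctr q.2) + t • (z q.1).2 :=
  sepVec_freeFlight_point_eq (chart_bound_point h.norm_vel_le h.window h.chart h.norm_le ht)

/-- **Before the reflection the sphere is off the scatterer**: `ρ < ‖x_i(t) - c‖` for `0 ≤ t < τ₀`. [folklore] -/
theorem lt_norm_wall_freeFlight_of_lt {t : ℝ} (ht0 : 0 ≤ t)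
    (ht : t < pairHitTime ρ ((Torus.geometry d).sepVec (z q.1).1 (ctr q.2)) (z q.1).2) :
    ρ < ‖(Torus.geometry d).sepVec (freeFlight (Torus.geometry d) t z q.1).1 (ctr q.2)‖ := by
  rw [h.sepVec_freeFlight_eq (by rw [abs_of_nonneg ht0]; exact ht.le.trans h.hitTime_le)]
  exact lt_norm_add_smul_of_lt_pairHitTime h.pairHits ht

/-- Before the reflection every sphere–scatterer pair is at distance `> ρ`. [folklore] -/
theorem lt_norm_wall_freeFlight_of_lt' {t : ℝ} (ht0 : 0 ≤ t)
    (ht : t < pairHitTime ρ ((Torus.geometry d).sepVec (z q.1).1 (ctr q.2)) (z q.1).2) (i : Fin N) (k : ι) :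
    ρ < ‖(Torus.geometry d).sepVec (freeFlight (Torus.geometry d) t z i).1 (ctr k)‖ := by
  refine lt_norm_of_wallOthersFar (r := 0) le_rfl (fun q' hq' => ?_) (h.lt_norm_wall_freeFlight_of_lt ht0 ht) i k
  rw [add_zero]
  exact h.lt_norm_wall_freeFlight_of_ne (by rw [abs_of_nonneg ht0]; exact ht.le.trans h.hitTime_le) hq'

/-- **The configuration at the hitting time**: the separation vector is the hit point. [folklore] -/
theorem sepVec_freeFlight_hitTime :
    (Torus.geometry d).sepVec (freeFlight (Torus.geometry d)
        (pairHitTime ρ ((Torus.geometry d).sepVec (z q.1).1 (ctr q.2)) (z q.1).2) z q.1).1 (ctr q.2) =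
      hitPoint ρ ((Torus.geometry d).sepVec (z q.1).1 (ctr q.2), (z q.1).2) := by
  rw [h.sepVec_freeFlight_eq (by rw [abs_of_nonneg h.hitTime_pos.le]; exact h.hitTime_le)]
  rfl

/-- At the hitting time the sphere touches the scatterer. [folklore] -/
theorem freeFlight_hitTime_mem_contact :
    (freeFlight (Torus.geometry d) (pairHitTime ρ ((Torus.geometry d).sepVec (z q.1).1 (ctr q.2)) (z q.1).2) z q.1).1 ∈
      (Wall.balls (Torus.geometry d) ctr ρ hρ q.2).contact := by
  rw [Wall.mem_balls_contact_iff, h.sepVec_freeFlight_hitTime, h.norm_hitPoint]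

/-- At the hitting time the sphere is wall-incoming (non-grazing). [folklore] -/
theorem isWallIncoming_freeFlight_hitTime :
    IsWallIncoming (Wall.balls (Torus.geometry d) ctr ρ hρ q.2)
      (freeFlight (Torus.geometry d) (pairHitTime ρ ((Torus.geometry d).sepVec (z q.1).1 (ctr q.2)) (z q.1).2) z) q.1 := by
  rw [Wall.isWallIncoming_balls_iff, h.sepVec_freeFlight_hitTime]
  simpa only [freeFlight_apply] using inner_hitPoint_neg h.good

/-- At the hitting time the configuration is confined. [folklore] -/
theorem freeFlight_hitTime_mem :
    freeFlight (Torus.geometry d) (pairHitTime ρ ((Torus.geometry d).sepVec (z q.1).1 (ctr q.2)) (z q.1).2) z ∈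
      confinedDomain (Torus.geometry d) (Wall.balls (Torus.geometry d) ctr ρ hρ) N ε := by
  have ht : |pairHitTime ρ ((Torus.geometry d).sepVec (z q.1).1 (ctr q.2)) (z q.1).2| ≤ δ := by
    rw [abs_of_nonneg h.hitTime_pos.le]; exact h.hitTime_le
  refine ⟨fun k l hkl => (h.lt_norm_pair_freeFlight ht hkl).le, fun i k => ?_⟩
  show ρ ≤ ‖(Torus.geometry d).sepVec _ (ctr k)‖
  by_cases hik : (i, k) = q
  · subst hik
    rw [h.sepVec_freeFlight_hitTime, h.norm_hitPoint]
  · exact (h.lt_norm_wall_freeFlight_of_ne ht hik).le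

/-- **At the hitting time the configuration is a simple wall event with contact `q`.** [folklore] -/
theorem isSimpleWallEventWith_freeFlight_hitTime :
    IsSimpleWallEventWith (Torus.geometry d) (Wall.balls (Torus.geometry d) ctr ρ hρ) ε
      (freeFlight (Torus.geometry d) (pairHitTime ρ ((Torus.geometry d).sepVec (z q.1).1 (ctr q.2)) (z q.1).2) z) q := by
  have ht : |pairHitTime ρ ((Torus.geometry d).sepVec (z q.1).1 (ctr q.2)) (z q.1).2| ≤ δ := by
    rw [abs_of_nonneg h.hitTime_pos.le]; exact h.hitTime_le
  refine ⟨(h.freeFlight_hitTime_mem_contact hρ), (h.isWallIncoming_freeFlight_hitTime hρ), fun i k hc => ?_, fun i j hij hc => ?_⟩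
  · by_contra hik
    have hik' : (i, k) ≠ q := fun he => hik (Prod.ext_iff.1 he)
    exact (h.lt_norm_wall_freeFlight_of_ne ht hik').ne' (Wall.mem_balls_contact_iff.1 hc)
  · exact (h.lt_norm_pair_freeFlight ht hij).ne' hc.2

/-- **The confined exit time is the hitting time.** [folklore] -/
theorem exitTime_eq :
    exitTime (Torus.geometry d) (Wall.balls (Torus.geometry d) ctr ρ hρ) ε z =
      ENNReal.ofReal (pairHitTime ρ ((Torus.geometry d).sepVec (z q.1).1 (ctr q.2)) (z q.1).2) := by
  set W := Wall.balls (Torus.geometry d) ctr ρ hρ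
  have hGρ := Torus.isHardSphereRegular_geometry (d := d) h.ρ_lt
  have hge : ENNReal.ofReal (pairHitTime ρ ((Torus.geometry d).sepVec (z q.1).1 (ctr q.2)) (z q.1).2) ≤
      exitTime (Torus.geometry d) W ε z := by
    refine le_exitTime_of_forall_mem fun t ht0 htlt => ?_
    have ht : t < pairHitTime ρ ((Torus.geometry d).sepVec (z q.1).1 (ctr q.2)) (z q.1).2 :=
      (ENNReal.ofReal_lt_ofReal_iff_of_nonneg ht0).1 htlt
    refine ⟨fun k l hkl => (h.lt_norm_pair_freeFlight ?_ hkl).le, fun i k => (h.lt_norm_wall_freeFlight_of_lt' ht0 ht i k).le⟩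
    rw [abs_of_nonneg ht0]; exact ht.le.trans h.hitTime_le
  have h0 := exitTime_eq_zero_of_isWallIncoming (ε := ε) hGρ (h.freeFlight_hitTime_mem_contact hρ) (h.isWallIncoming_freeFlight_hitTime hρ)
  have hadd := exitTime_freeFlight_add (G := Torus.geometry d) (W := W) (ε := ε) h.hitTime_pos.le hge
  rw [h0, zero_add] at hadd
  exact hadd.symm

/-- The confined exit time is finite. [folklore] -/
theorem exitTime_ne_top : exitTime (Torus.geometry d) (Wall.balls (Torus.geometry d) ctr ρ hρ) ε z ≠ ∞ := by
  rw [(h.exitTime_eq hρ)]; exact ENNReal.ofReal_ne_top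

/-- The confined exit time as a real number. [folklore] -/
theorem toReal_exitTime :
    (exitTime (Torus.geometry d) (Wall.balls (Torus.geometry d) ctr ρ hρ) ε z).toReal =
      pairHitTime ρ ((Torus.geometry d).sepVec (z q.1).1 (ctr q.2)) (z q.1).2 := by
  rw [(h.exitTime_eq hρ), ENNReal.toReal_ofReal h.hitTime_pos.le]

/-- **The event step is the specular reflection of the sphere at the hitting time.** [folklore] -/
theorem eventStep_eq :
    eventStep (Torus.geometry d) (Wall.balls (Torus.geometry d) ctr ρ hρ) ε z =
      reflectWall (Wall.balls (Torus.geometry d) ctr ρ hρ q.2) q.1 (freeFlight (Torus.geometry d)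
        (pairHitTime ρ ((Torus.geometry d).sepVec (z q.1).1 (ctr q.2)) (z q.1).2) z) := by
  have hs := (h.isSimpleWallEventWith_freeFlight_hitTime hρ)
  rw [← (h.toReal_exitTime hρ)] at hs ⊢
  exact eventStep_eq_reflectWall (h.exitTime_ne_top hρ) hs

/-- The first post-event state. [folklore] -/
theorem stateAfter_one :
    stateAfter (Torus.geometry d) (Wall.balls (Torus.geometry d) ctr ρ hρ) ε z 1 =
      reflectWall (Wall.balls (Torus.geometry d) ctr ρ hρ q.2) q.1 (freeFlight (Torus.geometry d)
        (pairHitTime ρ ((Torus.geometry d).sepVec (z q.1).1 (ctr q.2)) (z q.1).2) z) := by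
  rw [ConfinedAlexander.stateAfter_one, (h.eventStep_eq hρ)]

/-- The post-event state has the positions of the configuration at the hitting time. [folklore] -/
theorem stateAfter_one_apply_fst (k : Fin N) :
    (stateAfter (Torus.geometry d) (Wall.balls (Torus.geometry d) ctr ρ hρ) ε z 1 k).1 =
      (freeFlight (Torus.geometry d) (pairHitTime ρ ((Torus.geometry d).sepVec (z q.1).1 (ctr q.2)) (z q.1).2) z k).1 := by
  rw [(h.stateAfter_one hρ), reflectWall_apply_fst]

/-- The other spheres are unchanged by the reflection. [folklore] -/
theorem stateAfter_one_apply_of_ne {k : Fin N} (hk : k ≠ q.1) :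
    stateAfter (Torus.geometry d) (Wall.balls (Torus.geometry d) ctr ρ hρ) ε z 1 k =
      freeFlight (Torus.geometry d) (pairHitTime ρ ((Torus.geometry d).sepVec (z q.1).1 (ctr q.2)) (z q.1).2) z k := by
  rw [(h.stateAfter_one hρ), reflectWall_apply_of_ne _ hk]

/-- **The reflected velocity is the billiard one**: `v_i' = hitVel`. [folklore] -/
theorem vel_stateAfter_one :
    (stateAfter (Torus.geometry d) (Wall.balls (Torus.geometry d) ctr ρ hρ) ε z 1 q.1).2 =
      hitVel ρ ((Torus.geometry d).sepVec (z q.1).1 (ctr q.2), (z q.1).2) := by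
  rw [(h.stateAfter_one hρ), reflectWall_apply_self, Wall.balls_apply, Wall.ball_normal, Torus.geometry_sepVec,
    ← Torus.geometry_sepVec, h.sepVec_freeFlight_hitTime, specularReflect_inv_smul_eq_reflN h.ρ_pos h.norm_hitPoint,
    hitVel]
  rfl

/-- The post-event state is on the same energy shell, so its speeds are `≤ V`. [folklore] -/
theorem norm_vel_stateAfter_one_le (k : Fin N) :
    ‖(stateAfter (Torus.geometry d) (Wall.balls (Torus.geometry d) ctr ρ hρ) ε z 1 k).2‖ ≤ V := by
  refine norm_vel_le_of_configEnergy_le h.V_nonneg ?_ k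
  rw [(h.stateAfter_one hρ), configEnergy_reflectWall, configEnergy_freeFlight]
  exact h.energy

/-- **After the reflection no sphere touches a scatterer until the end of the window**: for
`0 < t` with `τ₀ + t ≤ δ`, every sphere of `S_t z₁` is at distance `> ρ` from every centre. [folklore] -/
theorem lt_norm_wall_freeFlight_stateAfter_one {t : ℝ} (ht : 0 < t)
    (htδ : pairHitTime ρ ((Torus.geometry d).sepVec (z q.1).1 (ctr q.2)) (z q.1).2 + t ≤ δ) (i : Fin N) (k : ι) :
    ρ < ‖(Torus.geometry d).sepVec (freeFlight (Torus.geometry d) t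
        (stateAfter (Torus.geometry d) (Wall.balls (Torus.geometry d) ctr ρ hρ) ε z 1) i).1 (ctr k)‖ := by
  set W := Wall.balls (Torus.geometry d) ctr ρ hρ
  have htδ' : |t| ≤ δ := by rw [abs_of_pos ht]; linarith [h.hitTime_pos.le]
  by_cases hik : (i, k) = q
  · obtain ⟨rfl, rfl⟩ := Prod.ext_iff.1 hik
    have hsep : (Torus.geometry d).sepVec (stateAfter (Torus.geometry d) W ε z 1 q.1).1 (ctr q.2) =
        hitPoint ρ ((Torus.geometry d).sepVec (z q.1).1 (ctr q.2), (z q.1).2) := by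
      rw [(h.stateAfter_one_apply_fst hρ), h.sepVec_freeFlight_hitTime]
    have hchart : ‖(Torus.geometry d).sepVec (stateAfter (Torus.geometry d) W ε z 1 q.1).1 (ctr q.2)‖ +
        |t| * ‖(stateAfter (Torus.geometry d) W ε z 1 q.1).2‖ < 1 / 2 := by
      rw [hsep, h.norm_hitPoint, (h.vel_stateAfter_one hρ), norm_hitVel h.ρ_pos h.good]
      have hv : ‖(z q.1).2‖ ≤ V := h.norm_vel_le q.1
      have h1 : |t| * ‖(z q.1).2‖ ≤ δ * V := mul_le_mul htδ' hv (norm_nonneg _) h.δ_pos.le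
      have : (2⁻¹ : ℝ) = 1 / 2 := by norm_num
      nlinarith [h.chart, h.window, h.r_nonneg, h.V_nonneg]
    rw [sepVec_freeFlight_point_eq hchart, hsep, (h.vel_stateAfter_one hρ)]
    exact lt_norm_hitPoint_add_smul_hitVel h.ρ_pos h.good ht
  · refine lt_norm_sepVec_freeFlight_point_of_far₂ h.norm_vel_le (h.norm_vel_stateAfter_one_le hρ)
      (h.stateAfter_one_apply_fst hρ) h.window h.hitTime_pos.le ?_ (h.othersFar (i, k) hik)
    rw [abs_of_pos ht]; exact htδ

/-- After the reflection every pair stays at distance `> ε` until the end of the window. [folklore] -/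
theorem lt_norm_pair_freeFlight_stateAfter_one {t : ℝ} (ht : 0 ≤ t)
    (htδ : pairHitTime ρ ((Torus.geometry d).sepVec (z q.1).1 (ctr q.2)) (z q.1).2 + t ≤ δ) {k l : Fin N} (hkl : k ≠ l) :
    ε < ‖(Torus.geometry d).sepVec
        (freeFlight (Torus.geometry d) t (stateAfter (Torus.geometry d) (Wall.balls (Torus.geometry d) ctr ρ hρ) ε z 1) k).1
        (freeFlight (Torus.geometry d) t (stateAfter (Torus.geometry d) (Wall.balls (Torus.geometry d) ctr ρ hρ) ε z 1) l).1‖ := by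
  refine Alexander.lt_norm_sepVec_freeFlight_of_far₂ h.norm_vel_le (h.norm_vel_stateAfter_one_le hρ)
    (h.stateAfter_one_apply_fst hρ) h.window h.hitTime_pos.le ?_ (h.farSet k l hkl)
  rw [abs_of_nonneg ht]; exact htδ

/-- The post-event state is confined. [folklore] -/
theorem stateAfter_one_mem :
    stateAfter (Torus.geometry d) (Wall.balls (Torus.geometry d) ctr ρ hρ) ε z 1 ∈
      confinedDomain (Torus.geometry d) (Wall.balls (Torus.geometry d) ctr ρ hρ) N ε := by
  rw [(h.stateAfter_one hρ), reflectWall_mem_confinedDomain_iff]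
  exact (h.freeFlight_hitTime_mem hρ)

variable [Finite ι]

/-- **The post-event state has no event within the window**: `τ(z₁) > δ - τ₀`. [folklore] -/
theorem ofReal_lt_exitTime_stateAfter_one :
    ENNReal.ofReal (δ - pairHitTime ρ ((Torus.geometry d).sepVec (z q.1).1 (ctr q.2)) (z q.1).2) <
      exitTime (Torus.geometry d) (Wall.balls (Torus.geometry d) ctr ρ hρ) ε
        (stateAfter (Torus.geometry d) (Wall.balls (Torus.geometry d) ctr ρ hρ) ε z 1) := by
  set W := Wall.balls (Torus.geometry d) ctr ρ hρ
  have hG := Torus.isHardSphereRegular_geometry (d := d) h.ε_lt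
  have hGρ := Torus.isHardSphereRegular_geometry (d := d) h.ρ_lt
  set τ₀ := pairHitTime ρ ((Torus.geometry d).sepVec (z q.1).1 (ctr q.2)) (z q.1).2 with hτ₀
  by_contra hle
  rw [not_lt] at hle
  have hfin : exitTime (Torus.geometry d) W ε (stateAfter (Torus.geometry d) W ε z 1) ≠ ∞ :=
    ne_top_of_le_ne_top ENNReal.ofReal_ne_top hle
  have hτ1 : (exitTime (Torus.geometry d) W ε (stateAfter (Torus.geometry d) W ε z 1)).toReal ≤ δ - τ₀ :=
    ENNReal.toReal_le_of_le_ofReal (by linarith [h.hitTime_le]) hle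
  rcases (ENNReal.toReal_nonneg : 0 ≤ (exitTime (Torus.geometry d) W ε (stateAfter (Torus.geometry d) W ε z 1)).toReal).eq_or_lt
    with h0 | hpos
  · rcases exists_event_freeFlight_exitTime hG hGρ (h.stateAfter_one_mem hρ) hfin with ⟨k, l, hkl, hc, -⟩ | ⟨k, l, hc, hin⟩
    · rw [← h0, freeFlight_zero] at hc
      have := (h.lt_norm_pair_freeFlight_stateAfter_one hρ) le_rfl (by rw [add_zero]; exact h.hitTime_le) hkl
      rw [freeFlight_zero] at this
      exact this.ne' hc.2
    · rw [← h0, freeFlight_zero] at hc hin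
      rw [(h.stateAfter_one_apply_fst hρ)] at hc
      have hout := (h.isSimpleWallEventWith_freeFlight_hitTime hρ).isWallOutgoing_reflectWall_of_mem_contact hc
      rw [← (h.stateAfter_one hρ)] at hout
      exact lt_asymm hin hout
  · rcases exists_event_freeFlight_exitTime hG hGρ (h.stateAfter_one_mem hρ) hfin with ⟨k, l, hkl, hc, -⟩ | ⟨k, l, hc, -⟩
    · exact (h.lt_norm_pair_freeFlight_stateAfter_one hρ hpos.le (by linarith) hkl).ne' hc.2
    · exact (h.lt_norm_wall_freeFlight_stateAfter_one hρ hpos (by linarith) k l).ne' (Wall.mem_balls_contact_iff.1 hc)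

/-- The second event instant is beyond the window. [folklore] -/
theorem ofReal_lt_eventInstant_two :
    ENNReal.ofReal δ < eventInstant (Torus.geometry d) (Wall.balls (Torus.geometry d) ctr ρ hρ) ε z 2 := by
  rw [eventInstant_succ, eventInstant_one, (h.exitTime_eq hρ)]
  have hsplit : ENNReal.ofReal δ = ENNReal.ofReal (pairHitTime ρ ((Torus.geometry d).sepVec (z q.1).1 (ctr q.2)) (z q.1).2) +
      ENNReal.ofReal (δ - pairHitTime ρ ((Torus.geometry d).sepVec (z q.1).1 (ctr q.2)) (z q.1).2) := by
    rw [← ENNReal.ofReal_add h.hitTime_pos.le (by linarith [h.hitTime_le]), add_sub_cancel]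
  rw [hsplit]
  exact ENNReal.add_lt_add_left ENNReal.ofReal_ne_top (h.ofReal_lt_exitTime_stateAfter_one hρ)

/-- **One reflection during the window: forward regularity up to `δ`.** [folklore] -/
theorem fwdGoodUpTo : FwdGoodUpTo (Torus.geometry d) (Wall.balls (Torus.geometry d) ctr ρ hρ) ε δ z := by
  set W := Wall.balls (Torus.geometry d) ctr ρ hρ
  have h2 := (h.ofReal_lt_eventInstant_two hρ)
  have hk2 : ∀ k, 2 ≤ k → ¬ eventInstant (Torus.geometry d) W ε z k ≤ ENNReal.ofReal δ :=
    fun k hk hle => (not_le.2 h2) ((monotone_eventInstant z hk).trans hle)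
  refine ⟨fun k hk => ?_, fun k t ht htk hkt => ?_, ⟨2, h2⟩⟩
  · cases k with
    | zero =>
      rw [stateAfter_zero, (h.toReal_exitTime hρ)]
      exact (h.isSimpleWallEventWith_freeFlight_hitTime hρ).isSimpleWallEvent.isSimpleEvent
    | succ k => exact (hk2 (k + 2) (by omega) hk).elim
  · match k with
    | 0 =>
      rw [stateAfter_zero]
      rw [stateAfter_zero, (h.exitTime_eq hρ), ENNReal.ofReal_lt_ofReal_iff_of_nonneg ht.le] at htk
      refine ⟨fun a b hab hc => (h.lt_norm_pair_freeFlight ?_ hab).ne' hc.2,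
        fun a b hc => (h.lt_norm_wall_freeFlight_of_lt' ht.le htk a b).ne' (Wall.mem_balls_contact_iff.1 hc)⟩
      rw [abs_of_pos ht]; exact htk.le.trans h.hitTime_le
    | 1 =>
      rw [eventInstant_one, (h.exitTime_eq hρ), ← ENNReal.ofReal_add h.hitTime_pos.le ht.le,
        ENNReal.ofReal_le_ofReal_iff h.δ_pos.le] at hkt
      exact ⟨fun a b hab hc => (h.lt_norm_pair_freeFlight_stateAfter_one hρ ht.le hkt hab).ne' hc.2,
        fun a b hc => (h.lt_norm_wall_freeFlight_stateAfter_one hρ ht hkt a b).ne' (Wall.mem_balls_contact_iff.1 hc)⟩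
    | k + 2 => exact (hk2 (k + 2) (by omega) ((le_add_right le_rfl).trans hkt)).elim

/-- **One reflection during the window: the flow at time `δ`** is `Φ_δ z = S_{δ - τ₀} z₁`. [folklore] -/
theorem fwdFlow_eq :
    fwdFlow (Torus.geometry d) (Wall.balls (Torus.geometry d) ctr ρ hρ) ε z δ = freeFlight (Torus.geometry d)
      (δ - pairHitTime ρ ((Torus.geometry d).sepVec (z q.1).1 (ctr q.2)) (z q.1).2)
      (stateAfter (Torus.geometry d) (Wall.balls (Torus.geometry d) ctr ρ hρ) ε z 1) := by
  have h1 : eventInstant (Torus.geometry d) (Wall.balls (Torus.geometry d) ctr ρ hρ) ε z 1 ≤ ENNReal.ofReal δ := by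
    rw [eventInstant_one, (h.exitTime_eq hρ)]; exact ENNReal.ofReal_le_ofReal h.hitTime_le
  rw [fwdFlow_eq_of_segment h1 (h.ofReal_lt_eventInstant_two hρ), eventInstant_one, (h.toReal_exitTime hρ)]

omit [Finite ι] in
/-- **The post-event state flowed back to time `0` is `wallCollide ρ ctr q z`.** [folklore] -/
theorem freeFlight_neg_stateAfter_one :
    freeFlight (Torus.geometry d) (-pairHitTime ρ ((Torus.geometry d).sepVec (z q.1).1 (ctr q.2)) (z q.1).2)
        (stateAfter (Torus.geometry d) (Wall.balls (Torus.geometry d) ctr ρ hρ) ε z 1) = wallCollide ρ ctr q z := by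
  funext k
  by_cases hk : k = q.1
  · subst hk
    refine Prod.ext ?_ ?_
    · simp only [freeFlight_apply, Torus.geometry_translate, wallCollide_apply_self, wallKickOne, wallData,
        (h.vel_stateAfter_one hρ), (h.stateAfter_one_apply_fst hρ)]
      rw [add_assoc, ← FunctionSpaces.Torus.proj_add]
      congr 2
      module
    · simp only [freeFlight_apply, wallCollide_apply_self, wallKickOne, wallData, (h.vel_stateAfter_one hρ)]
  · refine Prod.ext ?_ ?_
    · simp only [freeFlight_apply, Torus.geometry_translate, wallCollide_apply_of_ne hk, (h.stateAfter_one_apply_of_ne hρ) hk]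
      rw [add_assoc, ← FunctionSpaces.Torus.proj_add, neg_smul, add_neg_cancel, FunctionSpaces.Torus.proj_zero, add_zero]
    · simp only [freeFlight_apply, wallCollide_apply_of_ne hk, (h.stateAfter_one_apply_of_ne hρ) hk]

/-- **One reflection during the window: `Φ_δ z = S_δ (wallCollide ρ ctr q z)`.** [folklore] -/
theorem fwdFlow_eq_freeFlight_wallCollide :
    fwdFlow (Torus.geometry d) (Wall.balls (Torus.geometry d) ctr ρ hρ) ε z δ =
      freeFlight (Torus.geometry d) δ (wallCollide ρ ctr q z) := by
  rw [(h.fwdFlow_eq hρ), ← (h.freeFlight_neg_stateAfter_one hρ), ← freeFlight_add, sub_eq_add_neg]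

omit [Finite ι] in
/-- The post-event state recovered from `wallCollide`: `S_{τ₀} (wallCollide ρ ctr q z) = z₁`. [folklore] -/
theorem freeFlight_wallCollide :
    freeFlight (Torus.geometry d) (pairHitTime ρ ((Torus.geometry d).sepVec (z q.1).1 (ctr q.2)) (z q.1).2)
        (wallCollide ρ ctr q z) = stateAfter (Torus.geometry d) (Wall.balls (Torus.geometry d) ctr ρ hρ) ε z 1 := by
  rw [← (h.freeFlight_neg_stateAfter_one hρ), ← freeFlight_add, add_neg_cancel, freeFlight_zero]

end WallHitHyp

/-! ## The confined short-time good set: regularity, the one-step map, injectivity -/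

section CShortGood

variable {z : Config N d (UnitAddTorus d)}

omit [Fintype d] in
/-- A configuration of `wallFar` is in no wall hit piece. [folklore] -/
theorem not_mem_wallHitPiece_of_mem_wallFar [Fintype d] (hz : z ∈ wallFar N ctr ρ r) (q : Fin N × ι) :
    z ∉ wallHitPiece N ctr ε ρ r δ q :=
  fun h => (not_le.2 (hz q.1 q.2)) h.2.2.1

omit [Fintype d] in
/-- A configuration of `wallFar` is in no wall no-hit piece. [folklore] -/
theorem not_mem_wallNoHitPiece_of_mem_wallFar [Fintype d] (hz : z ∈ wallFar N ctr ρ r) (q : Fin N × ι) :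
    z ∉ wallNoHitPiece N ctr ε ρ r δ q :=
  fun h => (not_le.2 (hz q.1 q.2)) h.2.2.2.1

omit [Fintype d] in
/-- Two wall hit pieces with different contacts are disjoint. [folklore] -/
theorem eq_of_mem_wallHitPiece_of_mem_wallHitPiece [Fintype d] {q q' : Fin N × ι} (hz : z ∈ wallHitPiece N ctr ε ρ r δ q)
    (hz' : z ∈ wallHitPiece N ctr ε ρ r δ q') : q' = q := by
  by_contra hne
  exact (not_le.2 (hz.2.1 q' hne)) hz'.2.2.1

omit [Fintype d] in
/-- Two wall no-hit pieces with different contacts are disjoint. [folklore] -/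
theorem eq_of_mem_wallNoHitPiece_of_mem_wallNoHitPiece [Fintype d] {q q' : Fin N × ι} (hz : z ∈ wallNoHitPiece N ctr ε ρ r δ q)
    (hz' : z ∈ wallNoHitPiece N ctr ε ρ r δ q') : q' = q := by
  by_contra hne
  exact (not_le.2 (hz.2.1 q' hne)) hz'.2.2.2.1

omit [Fintype d] in
/-- A configuration of a wall no-hit piece is in no wall hit piece. [folklore] -/
theorem not_mem_wallHitPiece_of_mem_wallNoHitPiece [Fintype d] {q : Fin N × ι} (hz : z ∈ wallNoHitPiece N ctr ε ρ r δ q)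
    (q' : Fin N × ι) : z ∉ wallHitPiece N ctr ε ρ r δ q' := by
  intro h
  by_cases hq : q' = q
  · subst hq
    rcases hz.2.2.2.2 with hnh | hnh
    · exact hnh (PairHits.of_mem_billiardGood h.2.2.2.1)
    · exact (not_le.2 hnh) h.2.2.2.2
  · exact (not_le.2 (hz.2.1 q' hq)) h.2.2.1

/-- A configuration of a wall piece is in no pair hit piece (all its pairs are far). [folklore] -/
theorem not_mem_hitPiece_of_mem_farSet' (hz : z ∈ Alexander.farSet N ε r) {k l : Fin N} (hkl : k < l) :
    z ∉ Alexander.hitPiece N ε r δ k l :=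
  Alexander.not_mem_hitPiece_of_mem_farSet hz hkl.ne

/-- On a pair hit piece with all scatterers far the kick is the two-body collision map. [folklore] -/
theorem cKick_eq_pairCollide {i j : Fin N} (hij : i < j) (hz : z ∈ Alexander.hitPiece N ε r δ i j)
    (hw : z ∈ wallFar N ctr ρ r) : cKick N ctr ε ρ r δ z = Alexander.pairCollide ε i j z := by
  classical
  have hex : ∃ p : Fin N × Fin N, p.1 < p.2 ∧ z ∈ Alexander.hitPiece N ε r δ p.1 p.2 ∧ z ∈ wallFar N ctr ρ r :=
    ⟨(i, j), hij, hz, hw⟩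
  rw [cKick, dif_pos hex]
  obtain ⟨h1, h2⟩ := Alexander.eq_of_mem_hitPiece_of_mem_hitPiece hij hex.choose_spec.1 hz hex.choose_spec.2.1
  rw [h1, h2]

/-- On a wall hit piece the kick is the one-particle billiard of its contact. [folklore] -/
theorem cKick_eq_wallCollide {q : Fin N × ι} (hz : z ∈ wallHitPiece N ctr ε ρ r δ q) :
    cKick N ctr ε ρ r δ z = wallCollide ρ ctr q z := by
  classical
  have hno : ¬ ∃ p : Fin N × Fin N, p.1 < p.2 ∧ z ∈ Alexander.hitPiece N ε r δ p.1 p.2 ∧ z ∈ wallFar N ctr ρ r :=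
    fun ⟨p, hp, hmem, _⟩ => not_mem_hitPiece_of_mem_farSet' hz.1 hp hmem
  have hex : ∃ q : Fin N × ι, z ∈ wallHitPiece N ctr ε ρ r δ q := ⟨q, hz⟩
  rw [cKick, dif_neg hno, dif_pos hex, eq_of_mem_wallHitPiece_of_mem_wallHitPiece hz hex.choose_spec]

/-- Off the hit pieces the kick is the identity. [folklore] -/
theorem cKick_eq_self (h1 : ∀ k l : Fin N, k < l → z ∈ Alexander.hitPiece N ε r δ k l → z ∉ wallFar N ctr ρ r)
    (h2 : ∀ q : Fin N × ι, z ∉ wallHitPiece N ctr ε ρ r δ q) : cKick N ctr ε ρ r δ z = z := by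
  classical
  rw [cKick, dif_neg, dif_neg]
  · rintro ⟨q, hq⟩; exact h2 q hq
  · rintro ⟨p, hp, hmem, hw⟩; exact h1 p.1 p.2 hp hmem hw

/-- **No-event data meet no contact of either kind during the window.** [folklore] -/
theorem IsNoEventData.forall (hε : 0 < ε) (hρ0 : 0 < ρ) (hεr : ε + 2 * r < 2⁻¹) (hρr : ρ + 2 * r < 2⁻¹)
    (hr : 2 * V * δ ≤ r) (hV : ∀ i, ‖(z i).2‖ ≤ V) (hz : IsNoEventData ctr ε ρ r δ z) :
    (∀ t ∈ Icc (0 : ℝ) δ, ∀ k l : Fin N, k ≠ l →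
      ε < ‖(Torus.geometry d).sepVec (freeFlight (Torus.geometry d) t z k).1 (freeFlight (Torus.geometry d) t z l).1‖) ∧
    ∀ t ∈ Icc (0 : ℝ) δ, ∀ (i : Fin N) (k : ι),
      ρ < ‖(Torus.geometry d).sepVec (freeFlight (Torus.geometry d) t z i).1 (ctr k)‖ := by
  rcases hz with ⟨hp | ⟨p, -, hp⟩, hw⟩ | ⟨q, hq⟩
  · exact ⟨Alexander.forall_lt_norm_of_mem_farSet hV hr hp, forall_wall_of_mem_wallFar hV hr hw⟩
  · exact ⟨Alexander.forall_lt_norm_of_mem_noHitPiece hε hV hr hεr hp, forall_wall_of_mem_wallFar hV hr hw⟩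
  · exact ⟨forall_pair_of_mem_wallNoHitPiece hV hr hq, forall_wall_of_mem_wallNoHitPiece hρ0 hV hr hρr hq⟩

/-- On no-event data the kick is the identity. [folklore] -/
theorem IsNoEventData.cKick_eq (hz : IsNoEventData ctr ε ρ r δ z) : cKick N ctr ε ρ r δ z = z := by
  rcases hz with ⟨hp | ⟨p, hp, hmem⟩, hw⟩ | ⟨q, hq⟩
  · exact cKick_eq_self (fun k l hkl h _ => Alexander.not_mem_hitPiece_of_mem_farSet hp hkl.ne h)
      (not_mem_wallHitPiece_of_mem_wallFar hw)
  · exact cKick_eq_self (fun k l hkl h _ => Alexander.not_mem_hitPiece_of_mem_noHitPiece hp hmem hkl h)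
      (not_mem_wallHitPiece_of_mem_wallFar hw)
  · exact cKick_eq_self (fun k l hkl h _ => not_mem_hitPiece_of_mem_farSet' hq.1 hkl h)
      (not_mem_wallHitPiece_of_mem_wallNoHitPiece hq)

/-- **Trichotomy of the confined short-time good set**: no-event data, or a pair hit with all
scatterers far, or a wall hit. [folklore] -/
theorem trichotomy_of_mem_cShortGood (hz : z ∈ cShortGood N ctr ε ρ r δ) :
    IsNoEventData ctr ε ρ r δ z ∨
      (∃ p : Fin N × Fin N, p.1 < p.2 ∧ z ∈ Alexander.hitPiece N ε r δ p.1 p.2 ∧ z ∈ wallFar N ctr ρ r) ∨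
      ∃ q : Fin N × ι, z ∈ wallHitPiece N ctr ε ρ r δ q := by
  rcases mem_cShortGood.1 hz with ⟨hsg, hw⟩ | ⟨q, hq | hq⟩
  · rcases Alexander.mem_shortGood.1 hsg with h | ⟨p, hp, h | h⟩
    · exact Or.inl (Or.inl ⟨Or.inl h, hw⟩)
    · exact Or.inl (Or.inl ⟨Or.inr ⟨p, hp, h⟩, hw⟩)
    · exact Or.inr (Or.inl ⟨p, hp, h, hw⟩)
  · exact Or.inl (Or.inr ⟨q, hq⟩)
  · exact Or.inr (Or.inr ⟨q, hq⟩)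

variable [Finite ι]

/-- **Forward regularity up to `δ` on the confined short-time good set** (energy shell `E ≤ V²/2`,
`2Vδ ≤ r`, `ε + 2r < 1/2`, `ρ + 2r < 1/2`). [cite: GST2013, proof of Prop. 4.1.1 p. 19] -/
theorem fwdGoodUpTo_of_mem_cShortGood (hε : 0 < ε) (hεr : ε + 2 * r < 2⁻¹) (hρr : ρ + 2 * r < 2⁻¹)
    (hr : 2 * V * δ ≤ r) (hV0 : 0 ≤ V) (hδ : 0 ≤ δ) (hE : configEnergy z ≤ V ^ 2 / 2) (hz : z ∈ cShortGood N ctr ε ρ r δ) :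
    FwdGoodUpTo (Torus.geometry d) (Wall.balls (Torus.geometry d) ctr ρ hρ) ε δ z := by
  have hV : ∀ i, ‖(z i).2‖ ≤ V := norm_vel_le_of_configEnergy_le hV0 hE
  have hr0 : 0 ≤ r := le_trans (by positivity) hr
  have hε' : ε < 2⁻¹ := by linarith
  have hρ' : ρ < 2⁻¹ := by linarith
  rcases trichotomy_of_mem_cShortGood hz with h | ⟨p, hp, hmem, hw⟩ | ⟨q, hq⟩
  · obtain ⟨Hp, Hw⟩ := h.forall hε hρ hεr hρr hr hV
    exact fwdGoodUpTo_of_forall hρ hε' hρ' hδ Hp Hw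
  · exact PairHit.fwdGoodUpTo hρ (Alexander.HitHyp.mk hε hεr hr hV0 hE hp hmem) hw hρ'
  · exact (WallHitHyp.mk hε hεr hρ hρr hr hV0 hE hq).fwdGoodUpTo hρ

/-- **The confined flow at time `δ` on the confined short-time good set is `S_δ ∘ cKick`.** [cite: GST2013, proof of Prop. 4.1.1 p. 19] -/
theorem fwdFlow_eq_freeFlight_cKick (hε : 0 < ε) (hεr : ε + 2 * r < 2⁻¹) (hρr : ρ + 2 * r < 2⁻¹)
    (hr : 2 * V * δ ≤ r) (hV0 : 0 ≤ V) (hδ : 0 ≤ δ) (hE : configEnergy z ≤ V ^ 2 / 2) (hz : z ∈ cShortGood N ctr ε ρ r δ) :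
    fwdFlow (Torus.geometry d) (Wall.balls (Torus.geometry d) ctr ρ hρ) ε z δ =
      freeFlight (Torus.geometry d) δ (cKick N ctr ε ρ r δ z) := by
  have hV : ∀ i, ‖(z i).2‖ ≤ V := norm_vel_le_of_configEnergy_le hV0 hE
  have hr0 : 0 ≤ r := le_trans (by positivity) hr
  have hε' : ε < 2⁻¹ := by linarith
  have hρ' : ρ < 2⁻¹ := by linarith
  rcases trichotomy_of_mem_cShortGood hz with h | ⟨p, hp, hmem, hw⟩ | ⟨q, hq⟩
  · obtain ⟨Hp, Hw⟩ := h.forall hε hρ hεr hρr hr hV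
    rw [h.cKick_eq]
    exact fwdFlow_eq_freeFlight_of_forall hρ hε' hρ' hδ Hp Hw ⟨hδ, le_rfl⟩
  · rw [cKick_eq_pairCollide hp hmem hw]
    exact PairHit.fwdFlow_eq_freeFlight_pairCollide hρ (Alexander.HitHyp.mk hε hεr hr hV0 hE hp hmem) hw hρ'
  · rw [cKick_eq_wallCollide hq]
    exact (WallHitHyp.mk hε hεr hρ hρr hr hV0 hE hq).fwdFlow_eq_freeFlight_wallCollide hρ

/-- The confined flow stays confined during the window on the confined short-time good set. [folklore] -/
theorem fwdFlow_mem_of_mem_cShortGood (hε : 0 < ε) (hεr : ε + 2 * r < 2⁻¹) (hρr : ρ + 2 * r < 2⁻¹)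
    (hr : 2 * V * δ ≤ r) (hV0 : 0 ≤ V) (hδ : 0 ≤ δ) (hE : configEnergy z ≤ V ^ 2 / 2) (hz : z ∈ cShortGood N ctr ε ρ r δ)
    {s : ℝ} (hs : s ∈ Icc (0 : ℝ) δ) :
    fwdFlow (Torus.geometry d) (Wall.balls (Torus.geometry d) ctr ρ hρ) ε z s ∈
      confinedDomain (Torus.geometry d) (Wall.balls (Torus.geometry d) ctr ρ hρ) N ε :=
  (fwdGoodUpTo_of_mem_cShortGood hρ hε hεr hρr hr hV0 hδ hE hz).fwdFlow_mem hs.1 hs.2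

omit [Finite ι] in
include hρ in
/-- A no-wall-contact datum is not the wall kick of a wall hit datum. [folklore] -/
theorem WallHitHyp.wallCollide_ne {q : Fin N × ι} (h : WallHitHyp ctr ε ρ r δ V z q) {z' : Config N d (UnitAddTorus d)}
    (Hw : ∀ t ∈ Icc (0 : ℝ) δ, ∀ (i : Fin N) (k : ι),
      ρ < ‖(Torus.geometry d).sepVec (freeFlight (Torus.geometry d) t z' i).1 (ctr k)‖) :
    wallCollide ρ ctr q z ≠ z' := by
  intro heq
  have hc : (stateAfter (Torus.geometry d) (Wall.balls (Torus.geometry d) ctr ρ hρ) ε z 1 q.1).1 ∈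
      (Wall.balls (Torus.geometry d) ctr ρ hρ q.2).contact := by
    rw [h.stateAfter_one_apply_fst hρ]; exact h.freeFlight_hitTime_mem_contact hρ
  rw [← h.freeFlight_wallCollide hρ, heq] at hc
  exact (Hw _ ⟨h.hitTime_pos.le, h.hitTime_le⟩ q.1 q.2).ne' (Wall.mem_balls_contact_iff.1 hc)

omit [Finite ι] in
include hρ in
/-- **A pair kick is never a wall kick** (on the respective pieces): the kicked configuration
flowed to the later of the two event times would show both a forbidden and a required contact. [folklore] -/
theorem pairCollide_ne_wallCollide {i j : Fin N} (h : Alexander.HitHyp ε r δ V z i j) (hw : z ∈ wallFar N ctr ρ r)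
    {z' : Config N d (UnitAddTorus d)} {q : Fin N × ι} (h' : WallHitHyp ctr ε ρ r δ V z' q) :
    Alexander.pairCollide ε i j z ≠ wallCollide ρ ctr q z' := by
  intro heq
  set τ := pairHitTime ε ((Torus.geometry d).sepVec (z i).1 (z j).1) ((z i).2 - (z j).2) with hτ
  set τ' := pairHitTime ρ ((Torus.geometry d).sepVec (z' q.1).1 (ctr q.2)) (z' q.1).2 with hτ'
  rcases le_or_gt τ τ' with hle | hlt
  · have hc : (freeFlight (Torus.geometry d) τ' (wallCollide ρ ctr q z') q.1).1 ∈
        (Wall.balls (Torus.geometry d) ctr ρ hρ q.2).contact := by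
      rw [h'.freeFlight_wallCollide hρ, h'.stateAfter_one_apply_fst hρ]; exact h'.freeFlight_hitTime_mem_contact hρ
    rw [← heq] at hc
    have hsplit : freeFlight (Torus.geometry d) τ' (Alexander.pairCollide ε i j z) =
        freeFlight (Torus.geometry d) (τ' - τ) (Alexander.stateAfter (Torus.geometry d) ε z 1) := by
      rw [← h.freeFlight_pairCollide, ← freeFlight_add, sub_add_cancel]
    rw [hsplit] at hc
    exact (PairHit.lt_norm_wall_freeFlight_stateAfter_one h hw (sub_nonneg.2 hle) (by linarith [h'.hitTime_le]) q.1 q.2).ne'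
      (Wall.mem_balls_contact_iff.1 hc)
  · have hc : Alexander.stateAfter (Torus.geometry d) ε z 1 ∈ contactSet (Torus.geometry d) N ε i j :=
      (mem_contactSet_congr_fst fun m => h.stateAfter_one_apply_fst m).2 h.freeFlight_hitTime_mem_contactSet
    rw [← h.freeFlight_pairCollide, heq] at hc
    have hsplit : freeFlight (Torus.geometry d) τ (wallCollide ρ ctr q z') =
        freeFlight (Torus.geometry d) (τ - τ') (stateAfter (Torus.geometry d) (Wall.balls (Torus.geometry d) ctr ρ hρ) ε z' 1) := by
      rw [← h'.freeFlight_wallCollide hρ, ← freeFlight_add, sub_add_cancel]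
    rw [hsplit] at hc
    exact (h'.lt_norm_pair_freeFlight_stateAfter_one hρ (sub_pos.2 hlt).le (by linarith [h.hitTime_le]) h.ne).ne' hc.2

omit [Finite ι] in
include hρ in
/-- The event times of two wall hit data with the same kick agree in one direction. [folklore] -/
theorem WallHitHyp.hitTime_le_of_wallCollide_eq {q q' : Fin N × ι} (h : WallHitHyp ctr ε ρ r δ V z q)
    {z' : Config N d (UnitAddTorus d)} (h' : WallHitHyp ctr ε ρ r δ V z' q')
    (heq : wallCollide ρ ctr q z = wallCollide ρ ctr q' z') :
    pairHitTime ρ ((Torus.geometry d).sepVec (z' q'.1).1 (ctr q'.2)) (z' q'.1).2 ≤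
      pairHitTime ρ ((Torus.geometry d).sepVec (z q.1).1 (ctr q.2)) (z q.1).2 := by
  by_contra hlt
  rw [not_le] at hlt
  have hc : (freeFlight (Torus.geometry d) (pairHitTime ρ ((Torus.geometry d).sepVec (z' q'.1).1 (ctr q'.2)) (z' q'.1).2)
      (wallCollide ρ ctr q z) q'.1).1 ∈ (Wall.balls (Torus.geometry d) ctr ρ hρ q'.2).contact := by
    rw [heq, h'.freeFlight_wallCollide hρ, h'.stateAfter_one_apply_fst hρ]
    exact h'.freeFlight_hitTime_mem_contact hρ
  have hsplit : freeFlight (Torus.geometry d) (pairHitTime ρ ((Torus.geometry d).sepVec (z' q'.1).1 (ctr q'.2)) (z' q'.1).2)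
      (wallCollide ρ ctr q z) = freeFlight (Torus.geometry d)
      (pairHitTime ρ ((Torus.geometry d).sepVec (z' q'.1).1 (ctr q'.2)) (z' q'.1).2 -
        pairHitTime ρ ((Torus.geometry d).sepVec (z q.1).1 (ctr q.2)) (z q.1).2)
      (stateAfter (Torus.geometry d) (Wall.balls (Torus.geometry d) ctr ρ hρ) ε z 1) := by
    rw [← h.freeFlight_wallCollide hρ, ← freeFlight_add, sub_add_cancel]
  rw [hsplit] at hc
  exact (h.lt_norm_wall_freeFlight_stateAfter_one hρ (sub_pos.2 hlt) (by linarith [h'.hitTime_le]) q'.1 q'.2).ne'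
    (Wall.mem_balls_contact_iff.1 hc)

omit [Finite ι] in
include hρ in
/-- **Two wall hit data with the same kick coincide.** [folklore] -/
theorem WallHitHyp.eq_of_wallCollide_eq {q q' : Fin N × ι} (h : WallHitHyp ctr ε ρ r δ V z q)
    {z' : Config N d (UnitAddTorus d)} (h' : WallHitHyp ctr ε ρ r δ V z' q')
    (heq : wallCollide ρ ctr q z = wallCollide ρ ctr q' z') : z = z' := by
  set W := Wall.balls (Torus.geometry d) ctr ρ hρ
  have hτ : pairHitTime ρ ((Torus.geometry d).sepVec (z q.1).1 (ctr q.2)) (z q.1).2 =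
      pairHitTime ρ ((Torus.geometry d).sepVec (z' q'.1).1 (ctr q'.2)) (z' q'.1).2 :=
    le_antisymm (h'.hitTime_le_of_wallCollide_eq hρ h heq.symm) (h.hitTime_le_of_wallCollide_eq hρ h' heq)
  have h1 : stateAfter (Torus.geometry d) W ε z 1 = stateAfter (Torus.geometry d) W ε z' 1 := by
    rw [← h.freeFlight_wallCollide hρ, ← h'.freeFlight_wallCollide hρ, heq, hτ]
  have hcq : (stateAfter (Torus.geometry d) W ε z 1 q.1).1 ∈ (W q.2).contact := by
    rw [h.stateAfter_one_apply_fst hρ]; exact h.freeFlight_hitTime_mem_contact hρ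
  rw [h1, h'.stateAfter_one_apply_fst hρ] at hcq
  obtain ⟨e1, e2⟩ := (h'.isSimpleWallEventWith_freeFlight_hitTime hρ).eq_of_mem_contact hcq
  have hqq : q = q' := Prod.ext e1 e2
  subst hqq
  rw [h.stateAfter_one hρ, h'.stateAfter_one hρ, ← hτ] at h1
  have h2 := congrArg (reflectWall (W q.2) q.1) h1
  rw [reflectWall_reflectWall, reflectWall_reflectWall] at h2
  have h3 := congrArg (freeFlight (Torus.geometry d) (-pairHitTime ρ ((Torus.geometry d).sepVec (z q.1).1 (ctr q.2)) (z q.1).2)) h2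
  rwa [← freeFlight_add, ← freeFlight_add, neg_add_cancel, freeFlight_zero, freeFlight_zero] at h3

omit [Finite ι] in
include hρ in
/-- **The kick is injective on the confined short-time good part of an energy shell.** [folklore] -/
theorem cKick_injOn (hε : 0 < ε) (hεr : ε + 2 * r < 2⁻¹) (hρr : ρ + 2 * r < 2⁻¹) (hr : 2 * V * δ ≤ r) (hV0 : 0 ≤ V) :
    InjOn (cKick N ctr ε ρ r δ)
      (cShortGood N ctr ε ρ r δ ∩ {z : Config N d (UnitAddTorus d) | configEnergy z ≤ V ^ 2 / 2}) := by
  -- classification of a datum with its kick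
  have tri : ∀ z : Config N d (UnitAddTorus d), z ∈ cShortGood N ctr ε ρ r δ → configEnergy z ≤ V ^ 2 / 2 →
      IsNoEventData ctr ε ρ r δ z ∧ cKick N ctr ε ρ r δ z = z ∨
      (∃ p : Fin N × Fin N, Alexander.HitHyp ε r δ V z p.1 p.2 ∧ z ∈ wallFar N ctr ρ r ∧
        cKick N ctr ε ρ r δ z = Alexander.pairCollide ε p.1 p.2 z) ∨
      ∃ q : Fin N × ι, WallHitHyp ctr ε ρ r δ V z q ∧ cKick N ctr ε ρ r δ z = wallCollide ρ ctr q z := by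
    intro z hz hE
    rcases trichotomy_of_mem_cShortGood hz with h | ⟨p, hp, hmem, hw⟩ | ⟨q, hq⟩
    · exact Or.inl ⟨h, h.cKick_eq⟩
    · exact Or.inr (Or.inl ⟨p, Alexander.HitHyp.mk hε hεr hr hV0 hE hp hmem, hw, cKick_eq_pairCollide hp hmem hw⟩)
    · exact Or.inr (Or.inr ⟨q, WallHitHyp.mk hε hεr hρ hρr hr hV0 hE hq, cKick_eq_wallCollide hq⟩)
  rintro z ⟨hz, hE⟩ z' ⟨hz', hE'⟩ heq
  have hE₀ : configEnergy z ≤ V ^ 2 / 2 := hE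
  have hE₀' : configEnergy z' ≤ V ^ 2 / 2 := hE'
  have hV : ∀ i, ‖(z i).2‖ ≤ V := norm_vel_le_of_configEnergy_le hV0 hE₀
  have hV' : ∀ i, ‖(z' i).2‖ ≤ V := norm_vel_le_of_configEnergy_le hV0 hE₀'
  rcases tri z hz hE₀ with ⟨hn, hk⟩ | ⟨p, hp, hw, hk⟩ | ⟨q, hq, hk⟩ <;>
    rcases tri z' hz' hE₀' with ⟨hn', hk'⟩ | ⟨p', hp', hw', hk'⟩ | ⟨q', hq', hk'⟩
  · rwa [hk, hk'] at heq
  · rw [hk, hk'] at heq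
    exact absurd heq.symm (hp'.pairCollide_ne (hn.forall hε hρ hεr hρr hr hV).1)
  · rw [hk, hk'] at heq
    exact absurd heq.symm (hq'.wallCollide_ne hρ (hn.forall hε hρ hεr hρr hr hV).2)
  · rw [hk, hk'] at heq
    exact absurd heq (hp.pairCollide_ne (hn'.forall hε hρ hεr hρr hr hV').1)
  · rw [hk, hk'] at heq
    exact hp.eq_of_pairCollide_eq hp' heq
  · rw [hk, hk'] at heq
    exact absurd heq (pairCollide_ne_wallCollide hρ hp hw hq')
  · rw [hk, hk'] at heq
    exact absurd heq (hq.wallCollide_ne hρ (hn'.forall hε hρ hεr hρr hr hV').2)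
  · rw [hk, hk'] at heq
    exact absurd heq.symm (pairCollide_ne_wallCollide hρ hp' hw' hq)
  · rw [hk, hk'] at heq
    exact hq.eq_of_wallCollide_eq hρ hq' heq

end CShortGood

end ConfinedAlexander

end Kinetic

end

end Literature.Analysis.FluidPDE
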